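import Summits.CriticalPhenomena.SAWScalingLimit.Theorems.SAWDevelopingMapHexConjectureRangeIdentificationLattice
import Summits.CriticalPhenomena.SAWScalingLimit.Theorems.SAWDevelopingMapHexConjectureRangeIdentificationAvoid
import Summits.CriticalPhenomena.SAWScalingLimit.Theorems.SAWDevelopingMapHexConjectureRangeIdentificationBoundary
import Summits.CriticalPhenomena.SAWScalingLimit.Theorems.SAWDevelopingMapHexConjectureRangeIdentificationTransfer
import Summits.CriticalPhenomena.SAWScalingLimit.Theorems.SAWDevelopingMapObservableToSLERestrictionIdentifiesTransfer

/-!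
# Crux `HexConjecture` (stmt-CriticalPhenomena-0808), line `root-locality-replaces-loewner`,
registered stub `stub_rangeIdentification`: the avoidance cocycle identifies the RANGE of the
critical hexagonal SAW as the range of chordal SLE(8/3)

Landing target:
`Summits/CriticalPhenomena/SAWScalingLimit/Theorems/SAWDevelopingMapHexConjectureRangeIdentification.lean`
(`--supports stmt-CriticalPhenomena-0808`).  The theorem statement at the end is the REGISTERED
stub signature verbatim (`HexAvoidanceCocycle → HexRangeLimit`, skeleton
`Cruxes/HexConjecture/Lines/root-locality-replaces-loewner.lean`).

**Theorem.**  In the flat-boundary class, IF for every hull subdomain `D'` of the Dobrushin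
domain `(D; a, b)` and every chordal SLE(8/3) law `μ` of `D` the probabilities of the CLOSED
curve-space events `{range γ_δ ⊆ cl D'}` of the critical hexagonal SAW converge to
`μ {range ⊆ cl D'}` as the mesh `δ → 0⁺` (the avoidance cocycle WITH its value), THEN the range
`K_δ = range γ_δ ∈ NonemptyCompacts ℂ` converges in law (`TendstoLaw`, bounded continuous test
functions on the hyperspace) to the range of a chordal SLE(8/3) curve `Γ` of `D`.

**Proof** (parts 1a–3a in the sibling files `…RangeIdentification{Hyperspace, Lattice, Fill,
Avoid, Boundary, Transfer}`).  Fix a chordal uniformizing map `φ` and THE SLE(8/3) law `μ` of `D`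
through `φ` (`exists_sleLaw_through`: carried by the chordal carrier, avoidance probability of
`ψ(A)` equal to `Φ'_A(0)^{5/8}` for `*`-hulls `A`; `μ = law Γ` for an SLE(8/3) curve `Γ`).  By
`Filter.tendsto_of_subseq_tendsto` it suffices to treat sequences of meshes `s n → 0⁺`.  Part 1b
extracts (Prokhorov on the compact piece `{K ⊆ cl D}` of the hyperspace — NO tightness input) a
subsequence along which the range laws converge weakly to a probability measure `ν` inheriting
(H1) `μ{range ⊆ cl D'} ≤ ν{K ⊆ cl D'}`, (H2) `ν{K ∩ S = ∅} ≤ μ{range ⊆ cl D'}` (`cl D ∖ S ⊆ cl D'`)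
and (H3) `ν`-a.s. `K ⊆ cl D` connected through `a, b`.  IDENTIFICATION (`eq_map_range_of_inherits`):
`ν` is the image of `μ` under the trace map.  Indeed `ν`-a.e. `K` meets `∂D` only at `a, b`
(part 2c, collars); the avoidance identity (part 2b, [LSW] Lemma 3.2's squeeze through hull
subdomains with the fill lemma of part 2a) gives `ν{K ∩ ψ(T) = ∅} = μ{range ∩ ψ(T) = ∅}` for all
finite unions `T` of anchored test sets, i.e. equal image measures under the avoidance CODE of
the countable family `imageTest φ`; this code is injective on the Borel set `R₀` of chord ranges
(`injOn_missCode_imageTest`), so (Lusin–Souslin, part 3a) `ν`-a.e. `K` has the code of a chord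
`c`; then `K ∩ D ⊆ range c` (a point of `D` off `range c` is separated by a test set missing it),
`K ∩ ∂D ⊆ {a, b} ⊆ range c`, and `K ⊇ range c` because a connected subset of a simple arc through
its endpoints is the arc: `K = range c ∈ R₀`, and the transfer theorem gives `ν = μ ∘ range⁻¹`.
Hence every subsequential limit is `law (range Γ)` and `∫ f(K_δ) → ∫ f(range Γ)`.

References: G. F. Lawler, O. Schramm, W. Werner, *Conformal restriction: the chordal case*,
J. Amer. Math. Soc. **16** (2003), Lemma 3.2, Lemma 2.1, Thm. 6.1; P. Billingsley, *Convergence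
of probability measures* (1999), Thm. 2.1, 5.1; A. S. Kechris, *Classical Descriptive Set Theory*
(1995), Thm. 15.1; G. Matheron, *Random Sets and Integral Geometry* (1975), §2.2.
-/

noncomputable section

namespace Summit.CriticalPhenomena.SAWScalingLimit.Theorems.HexConjecture.RootLocality

open scoped Topology NNReal ENNReal BoundedContinuousFunction
open Filter Set Metric MeasureTheory TopologicalSpace
open UpperHalfPlane (upperHalfPlaneSet isOpen_upperHalfPlaneSet)
open Literature.Probability.LatticeModels (HexVertex hexGraph hexCenter)
open Literature.Probability.RandomPlanarGeometry
open Literature.Probability.RandomPlanarGeometry.SAW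
open Summit.CriticalPhenomena.SAWScalingLimit.Theorems.ObservableToSLE.FloorRatio (exists_sleLaw_through)

namespace Range

/-! ### Identification of a law inheriting (H1)–(H3) with the law of the SLE(8/3) range -/

section Identification

variable {D : DobrushinDomain} {φ : ConformalEquiv upperHalfPlaneSet D.carrier}

/-- The trace map is injective on the chordal carrier (a simple class is determined by its trace
and starting point). [folklore] -/
theorem injOn_rangeNC_chordalCarrier :
    InjOn (fun c : CurveClass ℂ =>
      (⟨⟨c.range, c.isCompact_range⟩, c.range_nonempty⟩ : NonemptyCompacts ℂ)) (chordalCarrier D) := by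
  intro c₁ h₁ c₂ h₂ h
  have hr : c₁.range = c₂.range := congrArg (fun K : NonemptyCompacts ℂ => (K : Set ℂ)) h
  exact CurveClass.eq_of_mem_simple_of_range_eq h₁.1.1.1 h₂.1.1.1 hr (h₁.1.1.2.trans h₂.1.1.2.symm)

variable [MeasurableSpace (NonemptyCompacts ℂ)] [BorelSpace (NonemptyCompacts ℂ)] in
/-- **IDENTIFICATION** (module docstring): a probability law `ν` on `NonemptyCompacts ℂ` which
inherits (H1), (H2) against THE chordal SLE(8/3) law `μ` of `(D; a, b)` through `φ` and is carried
by connected compact subsets of `cl D` containing both marked points IS the law of the range under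
`μ`. [cite: LawlerSchrammWerner2003Restriction, Lemma 3.2 (p. 10) with Lemma 2.1 and Thm. 6.1, transposed to random compact sets] -/
theorem eq_map_range_of_inherits (hφ : D.IsChordalUniformizing φ)
    {μ : Measure (CurveClass ℂ)} [IsProbabilityMeasure μ] (hμcar : ∀ᵐ c ∂μ, c ∈ chordalCarrier D)
    (hμav : ∀ (A : Set ℂ) (Φ : ConformalEquiv (upperHalfPlaneSet \ A) upperHalfPlaneSet) (d : ℝ),
      IsStarHull A → IsRestrictionMap A Φ → HasRestrictionDeriv A Φ d →
      μ (CurveClass.rangeSubset (φ.boundaryExtension '' A)ᶜ) = ENNReal.ofReal (d ^ ((5 : ℝ) / 8)))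
    {ν : Measure (NonemptyCompacts ℂ)} [IsProbabilityMeasure ν]
    (H1 : ∀ D' : DobrushinDomain, D.IsHullSubdomain D' →
      μ (CurveClass.rangeSubset (closure D'.carrier)) ≤ ν {K | (K : Set ℂ) ⊆ closure D'.carrier})
    (H2 : ∀ (D' : DobrushinDomain) (S : Set ℂ), D.IsHullSubdomain D' → IsClosed S →
      closure D.carrier \ S ⊆ closure D'.carrier →
      ν {K | Disjoint (K : Set ℂ) S} ≤ μ (CurveClass.rangeSubset (closure D'.carrier)))
    (H3 : ∀ᵐ (K : NonemptyCompacts ℂ) ∂ν, (K : Set ℂ) ⊆ closure D.carrier ∧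
      IsPreconnected (K : Set ℂ) ∧ D.pt 0 ∈ (K : Set ℂ) ∧ D.pt 1 ∈ (K : Set ℂ)) :
    ν = μ.map (fun c : CurveClass ℂ =>
      (⟨⟨c.range, c.isCompact_range⟩, c.range_nonempty⟩ : NonemptyCompacts ℂ)) := by
  classical
  have hC : JordanDomain.exists_continuousOn_extension := JordanDomain.exists_continuousOn_extension_holds
  have hJarc : Literature.Topology.PlaneTopology.JordanArcSeparation :=
    Literature.Topology.PlaneTopology.JordanArcSeparation_holds
  set rNC : CurveClass ℂ → NonemptyCompacts ℂ := fun c =>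
    ⟨⟨c.range, c.isCompact_range⟩, c.range_nonempty⟩ with hrNCdef
  have hrNC : Measurable rNC := continuous_rangeNC.measurable
  set ν₀ : Measure (NonemptyCompacts ℂ) := μ.map rNC with hν₀
  haveI : IsProbabilityMeasure ν₀ := Measure.isProbabilityMeasure_map hrNC.aemeasurable
  -- the full carrier property of `ν` (boundary avoidance, part 2c)
  have hμD : ∀ᵐ c ∂μ, c.range ⊆ closure D.carrier :=
    hμcar.mono fun c hc => (carrier_of_mem_chordalCarrier hc).1
  have hνbd := ae_inter_frontier_subset hφ hμD hμav H1
  have hνcar : ∀ᵐ (K : NonemptyCompacts ℂ) ∂ν, (K : Set ℂ) ⊆ closure D.carrier ∧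
      IsPreconnected (K : Set ℂ) ∧ D.pt 0 ∈ (K : Set ℂ) ∧ D.pt 1 ∈ (K : Set ℂ) ∧
      (K : Set ℂ) ∩ frontier D.carrier ⊆ {D.pt 0, D.pt 1} := by
    filter_upwards [H3, hνbd] with K h h'
    exact ⟨h.1, h.2.1, h.2.2.1, h.2.2.2, h'⟩
  -- the avoidance code of the image test sets
  set C : ℕ → Set ℂ := imageTest φ with hCdef
  have hCcl : ∀ n, IsClosed (C n) := fun n => isClosed_imageTest hC n
  set code : NonemptyCompacts ℂ → ℕ → Bool := fun K n =>
    @decide (Disjoint (K : Set ℂ) (C n)) (Classical.dec _) with hcodedef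
  have hcode_iff : ∀ (K : NonemptyCompacts ℂ) (n : ℕ), code K n = true ↔ Disjoint (K : Set ℂ) (C n) :=
    fun K n => @decide_eq_true_iff _ (Classical.dec _)
  have hcode_rNC : ∀ c : CurveClass ℂ, code (rNC c) = CurveClass.missCode C c := fun c => rfl
  have hcode_meas : Measurable code := by
    refine measurable_pi_iff.2 fun n => measurable_to_countable' fun b => ?_
    have ht : (fun K : NonemptyCompacts ℂ => code K n) ⁻¹' {true} =
        {K : NonemptyCompacts ℂ | Disjoint (K : Set ℂ) (C n)} := by
      ext K
      rw [mem_preimage, mem_singleton_iff, hcode_iff]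
      rfl
    have hmt : MeasurableSet {K : NonemptyCompacts ℂ | Disjoint (K : Set ℂ) (C n)} :=
      (Literature.MeasureTheory.RandomSets.isOpen_setOf_disjoint_of_isClosed (hCcl n)).measurableSet
    cases b
    · have hf : (fun K : NonemptyCompacts ℂ => code K n) ⁻¹' {false} =
          {K : NonemptyCompacts ℂ | Disjoint (K : Set ℂ) (C n)}ᶜ := by
        rw [← ht]
        ext K
        simp
      rw [hf]
      exact hmt.compl
    · rw [ht]
      exact hmt
  -- preimages of positive cylinders are avoidance events of finite unions
  have hpreX : ∀ s : Finset ℕ, code ⁻¹' CurveClass.posCylinder s =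
      {K : NonemptyCompacts ℂ | Disjoint (K : Set ℂ) (⋃ n ∈ s, C n)} := by
    intro s
    ext K
    simp only [mem_preimage, CurveClass.posCylinder, mem_setOf_eq, hcode_iff, disjoint_iUnion₂_right]
  have hpre0 : ∀ U : Set ℂ, rNC ⁻¹' {K : NonemptyCompacts ℂ | Disjoint (K : Set ℂ) U} =
      CurveClass.rangeSubset Uᶜ := by
    intro U
    ext c
    exact CurveClass.disjoint_range_iff
  -- agreement on cylinders: the avoidance identity (part 2b)
  have hagree : ∀ s : Finset ℕ,
      ν (code ⁻¹' CurveClass.posCylinder s) = ν₀ (code ⁻¹' CurveClass.posCylinder s) := by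
    intro s
    obtain ⟨hanch, hcpt, hcl, h0⟩ := biUnion_anchoredSeq s
    have hUcl : IsClosed (⋃ n ∈ s, C n) := s.finite_toSet.isClosed_biUnion fun n _ => hCcl n
    rw [hpreX, hν₀, Measure.map_apply hrNC
      (Literature.MeasureTheory.RandomSets.isOpen_setOf_disjoint_of_isClosed hUcl).measurableSet,
      hpre0, hCdef, biUnion_imageTest]
    rcases hanch with hempty | hanch
    · rw [hempty, image_empty]
      have h1 : {K : NonemptyCompacts ℂ | Disjoint (K : Set ℂ) (∅ : Set ℂ)} = univ :=
        eq_univ_of_forall fun K => disjoint_empty _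
      have h2 : (CurveClass.rangeSubset (∅ : Set ℂ)ᶜ : Set (CurveClass ℂ)) = univ := by
        ext c; simp [CurveClass.mem_rangeSubset]
      rw [h1, h2, measure_univ, measure_univ]
    · exact measure_setOf_disjoint_image_eq hφ hμcar hμav hνcar H1 H2 hcpt.isClosed
        hcpt.isBounded hcl h0 hanch.2
  have hmap : ν.map code = ν₀.map code := map_code_eq_of_forall_finset hcode_meas hagree
  -- the Borel set of chord ranges, on which the code is injective
  set R₀ : Set (NonemptyCompacts ℂ) := rNC '' chordalCarrier D with hR₀def
  have hR₀ : MeasurableSet R₀ :=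
    measurableSet_chordalCarrier.image_of_measurable_injOn hrNC injOn_rangeNC_chordalCarrier
  have hinj : InjOn code R₀ := by
    rintro _ ⟨c₁, h₁, rfl⟩ _ ⟨c₂, h₂, rfl⟩ h
    rw [hcode_rNC, hcode_rNC] at h
    rw [injOn_missCode_imageTest hJarc hC hφ h₁ h₂ h]
  have hν₀R : ∀ᵐ (K : NonemptyCompacts ℂ) ∂ν₀, K ∈ R₀ :=
    (ae_map_iff hrNC.aemeasurable hR₀).2 (hμcar.mono fun c hc => ⟨c, hc, rfl⟩)
  -- `ν`-a.e. `K` has the code of a chord, hence is the range of that chord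
  have hνR : ∀ᵐ (K : NonemptyCompacts ℂ) ∂ν, K ∈ R₀ := by
    have h1 := ae_exists_code_eq hcode_meas hR₀ hinj (μ := ν) (ν := ν₀) hν₀R hmap
    filter_upwards [h1, hνcar] with K hK hKc
    obtain ⟨_, ⟨c, hc, rfl⟩, hcodeq⟩ := hK
    refine ⟨c, hc, ?_⟩
    obtain ⟨-, -, hc0, hc1, -⟩ := carrier_of_mem_chordalCarrier hc
    have hKsub : (K : Set ℂ) ⊆ c.range := by
      intro x hx
      by_contra hxr
      by_cases hxD : x ∈ D.carrier
      · obtain ⟨n, hxn, hdisj⟩ := exists_index_separating_of_mem_carrier hJarc hC hφ hc hxD hxr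
        have h3 : code K n = true := by rw [← hcodeq]; exact (hcode_iff _ n).2 hdisj
        exact Set.disjoint_left.1 ((hcode_iff K n).1 h3) hx hxn
      · have hxfr : x ∈ frontier D.carrier := ⟨hKc.1 hx, by rwa [D.isOpen.interior_eq]⟩
        rcases hKc.2.2.2.2 ⟨hx, hxfr⟩ with hxa | hxb
        · exact hxr (hxa ▸ hc0)
        · exact hxr ((mem_singleton_iff.1 hxb) ▸ hc1)
    have hsrc : c.source = D.pt 0 := hc.1.1.2
    have htgt : c.target = D.pt 1 := hc.1.2
    have heq : (K : Set ℂ) = c.range :=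
      CurveClass.eq_range_of_isPreconnected_subset hc.1.1.1 hKc.2.1 hKsub (hsrc ▸ hKc.2.2.1)
        (htgt ▸ hKc.2.2.2.1)
    exact (NonemptyCompacts.ext heq).symm
  exact ext_of_map_code_eq hcode_meas hR₀ hinj hνR hν₀R hmap

end Identification

end Range

/-! ### The registered stub -/

/-- **Registered stub `stub_rangeIdentification`** (crux item stmt-CriticalPhenomena-0808, line
`root-locality-replaces-loewner`; statement verbatim from the skeleton: `HexAvoidanceCocycle →
HexRangeLimit`).  In the flat-boundary class, convergence of the probabilities of the closed hull
events `{range γ_δ ⊆ cl D'}` of the critical hexagonal SAW to their chordal SLE(8/3) values, for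
all hull subdomains `D'`, implies convergence in law of the RANGE of the walk in the hyperspace
`NonemptyCompacts ℂ` to the range of a chordal SLE(8/3) curve of `D` — with no tightness input
(module docstring for the proof: Prokhorov on the compact hyperspace piece, portmanteau
inheritance, boundary avoidance by collars, [LSW] Lemma 3.2's squeeze for random compact sets,
Lusin–Souslin transfer through the avoidance code of the anchored test family).
[cite: LawlerSchrammWerner2003Restriction, Lemma 3.2 (p. 10), Lemma 2.1 (p. 8), Thm. 6.1 (p. 23), transposed to random compact sets] -/
theorem stub_rangeIdentification : (∀ (D D' : Literature.Probability.RandomPlanarGeometry.DobrushinDomain) (ρ : ℝ) (a b : ℝ → Literature.Probability.LatticeModels.HexVertex) (μ : MeasureTheory.Measure (Literature.Probability.RandomPlanarGeometry.CurveClass ℂ)), 0 < ρ → (∀ i : Fin 2, D.carrier ∩ Metric.ball (D.pt i) ρ = {z : ℂ | (D.pt i).im < z.im} ∩ Metric.ball (D.pt i) ρ) → Literature.Probability.RandomPlanarGeometry.SAW.IsEmbEndpointApprox Literature.Probability.LatticeModels.hexGraph Literature.Probability.LatticeModels.hexCenter D a b → (∀ᶠ δ : ℝ in nhdsWithin (0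 : ℝ) (Set.Ioi 0), (a δ ∈ Literature.Probability.RandomPlanarGeometry.SAW.embMeshDomain Literature.Probability.LatticeModels.hexGraph Literature.Probability.LatticeModels.hexCenter D.carrier δ ∧ ∃ w, Literature.Probability.LatticeModels.hexGraph.Adj (a δ) w ∧ ¬ (Literature.Probability.RandomPlanarGeometry.SAW.hexDomainGraph D.carrier δ).Adj (a δ) w) ∧ (b δ ∈ Literature.Probability.RandomPlanarGeometry.SAW.embMeshDomain Literature.Probability.LatticeModels.hexGraph Literature.Probability.LatticeModels.hexCenter D.carrier δ ∧ ∃ w, Literature.Probability.LatticeModels.hexGraph.Adj (b δ) w ∧ ¬ (Literature.Probability.RandomPlanarGeometry.SAW.hexDomainGraph D.carrier δ).Adj (b δ) w)) → D.IsHullSubdomain D' → Literature.Probability.RandomPlanarGeometry.IsSLELaw ((8 : NNReal) / 3) D μ → Filter.Tendsto (fun δ : ℝ => ((Literature.Probability.RandomPlanarGeometry.SAW.hexSAWLaw D.carrier δ (a δ) (b δ)).map (fun γ : Literature.Probability.RandomPlanarGeometry.SAW.HexDomainSAW D.carrier δ (a δ) (b δ) => γ.curve)) (Literature.Probability.RandomPlanarGeometry.CurveClass.rangeSubset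 (closure D'.carrier))) (nhdsWithin (0 : ℝ) (Set.Ioi 0)) (nhds (μ (Literature.Probability.RandomPlanarGeometry.CurveClass.rangeSubset (closure D'.carrier))))) → ∀ (D : Literature.Probability.RandomPlanarGeometry.DobrushinDomain) (ρ : ℝ) (a b : ℝ → Literature.Probability.LatticeModels.HexVertex), 0 < ρ → (∀ i : Fin 2, D.carrier ∩ Metric.ball (D.pt i) ρ = {z : ℂ | (D.pt i).im < z.im} ∩ Metric.ball (D.pt i) ρ) → Literature.Probability.RandomPlanarGeometry.SAW.IsEmbEndpointApprox Literature.Probability.LatticeModels.hexGraph Literature.Probability.LatticeModels.hexCenter D a b → (∀ᶠ δ : ℝ in nhdsWithin (0 : ℝ) (Set.Ioi 0), (a δ ∈ Literature.Probability.RandomPlanarGeometry.SAW.embMeshDomain Literature.Probability.LatticeModels.hexGraph Literature.Probability.LatticeModels.hexCenter D.carrier δ ∧ ∃ w, Literature.Probability.LatticeModels.hexGraph.Adj (a δ) w ∧ ¬ (Literature.Probability.RandomPlanarGeometry.SAW.hexDomainGraph D.carrier δ).Adj (a δ) w) ∧ (b δ ∈ Literature.Probability.RandomPlanarGeometry.SAW.embMeshDomain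 Literature.Probability.LatticeModels.hexGraph Literature.Probability.LatticeModels.hexCenter D.carrier δ ∧ ∃ w, Literature.Probability.LatticeModels.hexGraph.Adj (b δ) w ∧ ¬ (Literature.Probability.RandomPlanarGeometry.SAW.hexDomainGraph D.carrier δ).Adj (b δ) w)) → ∃ Γ : (NNReal → ℝ) → Literature.Probability.RandomPlanarGeometry.CurveClass ℂ, Literature.Probability.RandomPlanarGeometry.IsSLECurve ((8 : NNReal) / 3) D Γ ∧ Literature.Probability.RandomPlanarGeometry.TendstoLaw (fun δ (γ : Literature.Probability.RandomPlanarGeometry.SAW.HexDomainSAW D.carrier δ (a δ) (b δ)) => (⟨⟨γ.curve.range, γ.curve.isCompact_range⟩, γ.curve.range_nonempty⟩ : TopologicalSpace.NonemptyCompacts ℂ)) (fun δ => Literature.Probability.RandomPlanarGeometry.SAW.hexSAWLaw D.carrier δ (a δ) (b δ)) (fun ω => (⟨⟨(Γ ω).range, (Γ ω).isCompact_range⟩, (Γ ω).range_nonempty⟩ : TopologicalSpace.NonemptyCompacts ℂ)) Literature.Probability.Process.preWienerMeasure := by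
  intro hCocycle D ρ a b hρ hflat hab hbd
  classical
  letI : MeasurableSpace (NonemptyCompacts ℂ) := borel _
  haveI : BorelSpace (NonemptyCompacts ℂ) := ⟨rfl⟩
  haveI := isProbabilityMeasure_preWienerMeasure'
  obtain ⟨φ, hφ⟩ := MarkedDomain.exists_isChordalUniformizing_holds D
  obtain ⟨μ, hμsle, hμP, hμcar, hμav⟩ := exists_sleLaw_through hφ
  obtain ⟨Γ, hΓ, hμΓ⟩ := id hμsle
  refine ⟨Γ, hΓ, ?_⟩
  intro f
  -- the cocycle for this domain and THE SLE(8/3) law `μ`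
  have hC : ∀ D' : DobrushinDomain, D.IsHullSubdomain D' →
      Tendsto (fun δ : ℝ => ((hexSAWLaw D.carrier δ (a δ) (b δ)).map
        (fun γ : HexDomainSAW D.carrier δ (a δ) (b δ) => γ.curve))
        (CurveClass.rangeSubset (closure D'.carrier)))
        (𝓝[>] 0) (𝓝 (μ (CurveClass.rangeSubset (closure D'.carrier)))) :=
    fun D' hD' => hCocycle D D' ρ a b μ hρ hflat hab hbd hD' hμsle
  -- the limit value is the integral against the law of the SLE range
  set rNC : CurveClass ℂ → NonemptyCompacts ℂ := fun c =>
    ⟨⟨c.range, c.isCompact_range⟩, c.range_nonempty⟩ with hrNCdef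
  have hrNCc : Continuous rNC := Range.continuous_rangeNC
  have hL : ∫ ω, f (⟨⟨(Γ ω).range, (Γ ω).isCompact_range⟩, (Γ ω).range_nonempty⟩ : NonemptyCompacts ℂ)
        ∂Literature.Probability.Process.preWienerMeasure = ∫ K, f K ∂(μ.map rNC) := by
    have h1 : ∫ K, f K ∂(μ.map rNC) = ∫ c, f (rNC c) ∂μ :=
      integral_map hrNCc.measurable.aemeasurable f.continuous.aestronglyMeasurable
    have h2 : ∫ c, f (rNC c) ∂μ =
        ∫ ω, f (rNC (Γ ω)) ∂Literature.Probability.Process.preWienerMeasure := by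
      rw [hμΓ]
      exact integral_map hΓ.aemeasurable (f.continuous.comp hrNCc).aestronglyMeasurable
    rw [h1, h2]
  rw [hL]
  refine tendsto_of_subseq_tendsto fun s hs => ?_
  obtain ⟨N₀, φs, ν, -, hint, H1, H2, H3⟩ := Range.exists_subseqLimit hab μ hC hs
  have hνeq : (ν : Measure (NonemptyCompacts ℂ)) = μ.map rNC :=
    Range.eq_map_range_of_inherits hφ hμcar hμav H1 H2 H3
  refine ⟨fun n => φs n + N₀, ?_⟩
  rw [← hνeq]
  exact hint f

end Summit.CriticalPhenomena.SAWScalingLimit.Theorems.HexConjecture.RootLocality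

end
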